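/-
Copyright (c) 2026 the pub-hodgecm-mathlib formalisation cell (harness21).  Prover seat hodgecm-mathlib-K2E1-p12 (g6), Track B ∕ K2-LIT, h413 = `stmt-HodgeConjecture-24833`,
R90-TF section S8 «ContSpec-n½», ESTATE T §6 (S8 dealer R90-CS-plan (g3) S8-R208 (1) ∕ S8-R214 J-S8-T2′ «§6 additivity as planned» ∕ S8-R215): ADDITIVITY OF THE PER-GENERATOR EXPORTS ROW
— the exports clause list of ★ `K2E1ChiEisensteinMeromorphicExportsKFiniteCMThree` (continuation `Ec′`, closed co-discrete pole set `P ⊆ {Re ≤ 2}`, tube identity, analyticity, (E4),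
(E2-bd) off `P`) is closed under FINITE SUMS of sections, so the row `hTEXP` of ★ p864446 at ALL `K_∞`-finite τ-admissible generators follows from the row at PURE-TYPE blocks (★ §5).
-/
import Summits.HodgeConjecture.HodgeConjecture.Theorems.R90S8ResGMidAtomTauPureSplitU3      -- ★ p864443 (this seat) §5: `exists_finset_sum_pure_blocks_of_isArchFinite`, `commute_tauLevel_archMaximalCompact`; brings ★ laws p864264∕p864292, ★ τ-DEFS p864157, ★ β2 p864185 (hence ★ p864054 `exists_norm_le_of_isChiSectionPair`)
import Literature.NumberTheory.Automorphic.UnitaryGroupCongruenceSubgroupLevels                -- ★ `exists_finCongruenceLevel_span_le_of_isOpen` (open subgroups contain a principal level)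
import Literature.NumberTheory.Automorphic.BorelStabilizerLattice                            -- ★ `BigHeckeGLn.conj_mem_comap_principalCongruenceLevel` (`K_f(𝔫) ⊴ GL₃(𝒪̂)`)
import Mathlib.Analysis.Analytic.Constructions                                               -- Mathlib `Finset.analyticAt_sum`
import HarnessLib

/-!
# R90-TF · S8 «ContSpec-n½» — `R90S8ResGMidExportsRowAdditiveU3`: ESTATE T §6 — THE EXPORTS ROW IS ADDITIVE; `hTEXP` AT EVERY `K_∞`-FINITE τ-ADMISSIBLE GENERATOR FROM THE PURE BLOCKS

Cell `hodgecm-mathlib`, crux H413 (`stmt-HodgeConjecture-24833`, lane `--supports … --as helper`), route of record `HCCMUnconditional`; R90-TF section S8, sub-socket (R)′ ∕ (V) in ESTATE T's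
currency.  THEOREMS ONLY (no `def`, no `instance`, no `notation`, no named-fact hypothesis, no `sorry`; default heartbeats); count-neutral; CLOSES NO SOCKET; NO measure theory beyond the
`hsum` letter's statement.

THE ROW.  ★ p864446 `hEXP_tauRow_of_exportsRow (hTEXP)` (K2E1-p11) pays (R)′'s `hEXP` ∀-row from the per-generator EXPORTS ROW `hTEXP`: for every τ-admissible `(U₀, φ)` (`IsTauLevel U₀`,
`φ ∈ V(χ₁, χ₂; tauLevel U₀, 1)` continuous, `IsArchFinite φ`) SOME continuation `Ec′` of `z ↦ E(f_z^φ)` with a closed co-discrete `P ⊆ {Re ≤ 2}`, analytic ∕ (E4) ∕ (E2-bd) off `P`.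
The K-finite exports head ★ p864350 (∘ the τ-ports ★ p864413 ∕ ★ p864428, K2E1-p15's `…OfPorts`) delivers this clause list for `φ` in a PURE-TYPE block; ★ §5 splits every
arch-finite `φ` into finitely many `cᵢ` in pure blocks.  THIS FILE closes the gap: the clause list is ADDITIVE.
* §6.0 `flatSectionU_finsetSum` (`f_z^{Σ cᵢ} = Σ f_z^{cᵢ}`), `eisensteinSeriesU_finsetSum_apply` (`E(Σ fᵢ) = Σ E(fᵢ)` given termwise summability, ★ `eisensteinSeriesU_add`), level bookkeeping
  `chiSectionSpacePair_tauLevel_mono` (`U₁ ≤ U₀ ⇒ V(tauLevel U₀, 1) ≤ V(tauLevel U₁, 1)`), `exists_normal_tauLevel_le` (every τ-level contains a principal level `K(n𝓞)_f`, which is a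
  τ-level NORMALISED by `G(𝒪̂)_f` — ★ `exists_finCongruenceLevel_span_le_of_isOpen`, ★ `conj_mem_comap_principalCongruenceLevel`).
* §6.1 **`exportsRow_finset_sum`**: if each `cᵢ` (`i ∈ ι` finite) has an exports datum `(Ecᵢ, Pᵢ)` and the Eisenstein series of each `f_z^{cᵢ}` converges absolutely on `2 < Re` (`hsumᵢ`),
  then `Σ cᵢ` has the exports datum `(Σ Ecᵢ, ⋃ Pᵢ)`: a finite union of closed co-discrete sets `⊆ {Re ≤ 2}` is one (`Filter.eventually_all`); the tube identity adds up (§6.0);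
  `Finset.analyticAt_sum`; `continuous_finset_sum`; the joint bounds add on the finite intersection of the neighbourhoods (`Filter.iInter_mem`, `norm_sum_le`).
* §6.2 **HEAD — `exportsTauRow_of_pureBlocks`**: for the `φ_ξ`-block with UNITARY characters (`hχ₁u`, `hχ₂u` — continuous pair-sections are then bounded, ★ `exists_norm_le_of_isChiSectionPair`)
  and the Godement letter `hsum` (★ `hSUM_of_unitary`), the PURE-BLOCK EXPORTS LETTER `hPURE` («every `φ` in a pure block `V` as packaged by ★ §5d has an exports datum») implies `hTEXP`
  for EVERY τ-admissible generator: shrink `U₀` to a normal principal level (§6.0), split `φ` by ★ `exists_finset_sum_pure_blocks_of_isArchFinite`, export each piece by `hPURE`, add by §6.1.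
  Consumer: `hEXP := hEXP_tauRow_of_exportsRow L μ (exportsTauRow_of_pureBlocks L ξ μω hχ₁u hχ₂u hsum hPURE)`.
VISIBLE LETTER: `hPURE` — at pure blocks it is ★ p864350 modulo row 1's gauge letters at the block, i.e. the τ-ports (★ p864413, ★ p864428) assembled by K2E1-p15's `…KFiniteOfPorts`; its block
binders are EXACTLY ★ §5d's package (`FiniteDimensional`, `hVK`, `hVχ`, `hVc`, `hVM`, level, `K_max`-irreducible, pure `K_∞`-type).
HONEST LABEL: HC_CM is proved only modulo the 7 printed citations (2 remaining named inputs: hLiu418 = `stmt-HodgeConjecture-24832`, h413 = `stmt-HodgeConjecture-24833`) until rung 0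
closes; additivity pays no socket; ESTATE T = ★ head + ★ ports + ★ §5 + THIS §6 modulo `hPURE`'s assembly; REL ≠ ★ ≠ WRITTEN ≠ BUILT; count-neutral.

## References
* [MoeglinWaldspurger1995] C. Mœglin, J.-L. Waldspurger, *Spectral Decomposition and Eisenstein Series* (1995), II.1.5 (absolute convergence, linearity), IV.1.9–IV.1.11 (continuation of
  `K`-finite Eisenstein series).
* [BernsteinLapid2019] J. Bernstein, E. Lapid, *On the meromorphic continuation of Eisenstein series*, J. Amer. Math. Soc. 37 (2024), Thm 2.3, §4.
* [BorelJacquet1979] A. Borel, H. Jacquet, *Automorphic forms and automorphic representations*, Proc. Symp. Pure Math. 33.1 (1979), §4.1 (principal congruence levels).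
-/

set_option autoImplicit false
set_option linter.dupNamespace false  -- the mandated namespace `…HodgeConjecture.HodgeConjecture.R90.S8` (LEAD #1 L1) repeats the summit's segment

noncomputable section

open MeasureTheory Measure Set Filter Topology NumberField IsDedekindDomain
open Literature.NumberTheory Literature.NumberTheory.Automorphic Literature.NumberTheory.Automorphic.UnitaryGroup Literature.NumberTheory.GaloisRepresentations AdelicGroupData
open Literature.NumberTheory.Automorphic.Arthur2013.Leaves.TECR Literature.NumberTheory.Rogawski1990
open Summit.HodgeConjecture.HodgeConjecture.Cruxes.H413.K2E1BorelEisensteinU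
open Summit.HodgeConjecture.HodgeConjecture.Cruxes.H413.K2E1CharacterEisensteinU3PairDefs
open Summit.HodgeConjecture.HodgeConjecture.Cruxes.H413.K2E1ChiSectionSpaceU3PairDefs
open scoped ENNReal NNReal

namespace Summit.HodgeConjecture.HodgeConjecture.R90.S8

variable (L : Type) [Field L] [NumberField L] [IsCMField L]

/-! ## §6.0 Finite sums of flat sections and Eisenstein series; level bookkeeping -/

/-- **`f_z^{Σ cᵢ} = Σ f_z^{cᵢ}`** (the flat section is linear in the section). [cite: MoeglinWaldspurger1995, II.1.5] -/
theorem flatSectionU_finsetSum {ι : Type*} (s : Finset ι) (c : ι → (quasiSplit (↥(maximalRealSubfield L)) L (IsCMField.complexConj L) 3).Adelic → ℂ) (z : ℂ) :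
    flatSectionU (∑ i ∈ s, c i) z = ∑ i ∈ s, flatSectionU (c i) z := by
  funext g
  simp only [flatSectionU_apply, Finset.sum_apply, Finset.sum_mul]

/-- **`E(Σ fᵢ)(g) = Σ E(fᵢ)(g)`** when every series `E(fᵢ)(g)` converges (★ `eisensteinSeriesU_add`, induction on the finite index set). [cite: MoeglinWaldspurger1995, II.1.5] -/
theorem eisensteinSeriesU_finsetSum_apply {ι : Type*} (s : Finset ι) (f : ι → (quasiSplit (↥(maximalRealSubfield L)) L (IsCMField.complexConj L) 3).Adelic → ℂ) (g : (quasiSplit (↥(maximalRealSubfield L)) L (IsCMField.complexConj L) 3).Adelic)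
    (hs : ∀ i ∈ s, Summable fun q : (Quotient (MulAction.orbitRel ↥(borelU ((IsCMField.complexConj L : L ≃ₐ[↥(maximalRealSubfield L)] L) : L →+* L) ((StdForm.antidiagonal 3).over L)) ↥(unitaryGroupOfForm ((IsCMField.complexConj L : L ≃ₐ[↥(maximalRealSubfield L)] L) : L →+* L) ((StdForm.antidiagonal 3).over L)))) => f i (((quasiSplit (↥(maximalRealSubfield L)) L (IsCMField.complexConj L) 3).toAdelic (Quotient.out q : ↥(unitaryGroupOfForm ((IsCMField.complexConj L : L ≃ₐ[↥(maximalRealSubfield L)] L) : L →+* L) ((StdForm.antidiagonal 3).over L)))) * g)) :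
    eisensteinSeriesU (∑ i ∈ s, f i) g = ∑ i ∈ s, eisensteinSeriesU (f i) g := by
  classical
  induction s using Finset.induction_on with
  | empty =>
    rw [Finset.sum_empty, Finset.sum_empty]
    exact eisensteinSeriesU_zero g
  | insert a s ha ih =>
    have hsa : Summable fun q : (Quotient (MulAction.orbitRel ↥(borelU ((IsCMField.complexConj L : L ≃ₐ[↥(maximalRealSubfield L)] L) : L →+* L) ((StdForm.antidiagonal 3).over L)) ↥(unitaryGroupOfForm ((IsCMField.complexConj L : L ≃ₐ[↥(maximalRealSubfield L)] L) : L →+* L) ((StdForm.antidiagonal 3).over L)))) => f a (((quasiSplit (↥(maximalRealSubfield L)) L (IsCMField.complexConj L) 3).toAdelic (Quotient.out q : ↥(unitaryGroupOfForm ((IsCMField.complexConj L : L ≃ₐ[↥(maximalRealSubfield L)] L) : L →+* L) ((StdForm.antidiagonal 3).over L)))) * g) := hs a (Finset.mem_insert_self a s)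
    have hss : ∀ i ∈ s, Summable fun q : (Quotient (MulAction.orbitRel ↥(borelU ((IsCMField.complexConj L : L ≃ₐ[↥(maximalRealSubfield L)] L) : L →+* L) ((StdForm.antidiagonal 3).over L)) ↥(unitaryGroupOfForm ((IsCMField.complexConj L : L ≃ₐ[↥(maximalRealSubfield L)] L) : L →+* L) ((StdForm.antidiagonal 3).over L)))) => f i (((quasiSplit (↥(maximalRealSubfield L)) L (IsCMField.complexConj L) 3).toAdelic (Quotient.out q : ↥(unitaryGroupOfForm ((IsCMField.complexConj L : L ≃ₐ[↥(maximalRealSubfield L)] L) : L →+* L) ((StdForm.antidiagonal 3).over L)))) * g) := fun i hi => hs i (Finset.mem_insert_of_mem hi)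
    have hsum_s : Summable fun q : (Quotient (MulAction.orbitRel ↥(borelU ((IsCMField.complexConj L : L ≃ₐ[↥(maximalRealSubfield L)] L) : L →+* L) ((StdForm.antidiagonal 3).over L)) ↥(unitaryGroupOfForm ((IsCMField.complexConj L : L ≃ₐ[↥(maximalRealSubfield L)] L) : L →+* L) ((StdForm.antidiagonal 3).over L)))) => (∑ i ∈ s, f i) (((quasiSplit (↥(maximalRealSubfield L)) L (IsCMField.complexConj L) 3).toAdelic (Quotient.out q : ↥(unitaryGroupOfForm ((IsCMField.complexConj L : L ≃ₐ[↥(maximalRealSubfield L)] L) : L →+* L) ((StdForm.antidiagonal 3).over L)))) * g) := by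
      have h : (fun q : (Quotient (MulAction.orbitRel ↥(borelU ((IsCMField.complexConj L : L ≃ₐ[↥(maximalRealSubfield L)] L) : L →+* L) ((StdForm.antidiagonal 3).over L)) ↥(unitaryGroupOfForm ((IsCMField.complexConj L : L ≃ₐ[↥(maximalRealSubfield L)] L) : L →+* L) ((StdForm.antidiagonal 3).over L)))) => (∑ i ∈ s, f i) (((quasiSplit (↥(maximalRealSubfield L)) L (IsCMField.complexConj L) 3).toAdelic (Quotient.out q : ↥(unitaryGroupOfForm ((IsCMField.complexConj L : L ≃ₐ[↥(maximalRealSubfield L)] L) : L →+* L) ((StdForm.antidiagonal 3).over L)))) * g)) = fun q : (Quotient (MulAction.orbitRel ↥(borelU ((IsCMField.complexConj L : L ≃ₐ[↥(maximalRealSubfield L)] L) : L →+* L) ((StdForm.antidiagonal 3).over L)) ↥(unitaryGroupOfForm ((IsCMField.complexConj L : L ≃ₐ[↥(maximalRealSubfield L)] L) : L →+* L) ((StdForm.antidiagonal 3).over L)))) => ∑ i ∈ s, f i (((quasiSplit (↥(maximalRealSubfield L)) L (IsCMField.complexConj L) 3).toAdelic (Quotient.out q : ↥(unitaryGroupOfForm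 ((IsCMField.complexConj L : L ≃ₐ[↥(maximalRealSubfield L)] L) : L →+* L) ((StdForm.antidiagonal 3).over L)))) * g) := funext fun q => Finset.sum_apply _ _ _
      rw [h]
      exact summable_sum hss
    rw [Finset.sum_insert ha, Finset.sum_insert ha, eisensteinSeriesU_add hsa hsum_s, ih hss]

variable {χ₁ : HeckeCharacter L} {χ₂ : ↥(TorusDict.torus (IsCMField.complexConj L)) →ₜ* ℂˣ}

/-- **Shrinking the τ-level keeps the section**: `U₁ ≤ U₀ ⇒ V(χ₁, χ₂; tauLevel U₀, 1) ≤ V(χ₁, χ₂; tauLevel U₁, 1)` (right invariance under a smaller group). [cite: BorelJacquet1979, §4.1] -/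
theorem chiSectionSpacePair_tauLevel_mono {U₀ U₁ : Subgroup ↥(finAdelic (↥(maximalRealSubfield L)) L (IsCMField.complexConj L) 3 ((StdForm.antidiagonal 3).over L))} (h : U₁ ≤ U₀) :
    chiSectionSpacePair χ₁ χ₂ (tauLevel L U₀) ((1 : ↥(tauLevel L U₀) →* ℂ) : ↥(tauLevel L U₀) → ℂ) ≤
      chiSectionSpacePair χ₁ χ₂ (tauLevel L U₁) ((1 : ↥(tauLevel L U₁) →* ℂ) : ↥(tauLevel L U₁) → ℂ) := by
  intro φ hφ
  refine mem_chiSectionSpacePair (isChiSectionPair_of_mem hφ) fun g k => ?_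
  obtain ⟨b, hb, hbk⟩ := (mem_tauLevel_iff L U₁ (k : (quasiSplit (↥(maximalRealSubfield L)) L (IsCMField.complexConj L) 3).Adelic)).1 k.2
  have h2 := apply_mul_of_mem hφ g ⟨_, finAdelicToAdelic_mem_tauLevel L (h hb)⟩
  rw [MonoidHom.one_apply, one_mul] at h2
  rw [MonoidHom.one_apply, one_mul, ← hbk]
  exact h2

/-- **Every τ-level contains a NORMAL τ-level**: an open `U₀ ≤ G(𝒪̂)_f` contains a principal level `U₁ = K(n𝓞_L)_f` (`n ≠ 0`; ★ `exists_finCongruenceLevel_span_le_of_isOpen`), which is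
a τ-level (★ `isOpen_finCongruenceLevel`, ★ `isCompact_finCongruenceLevel`, ★ `finCongruenceLevel_le_integralLevel`) normalised by `G(𝒪̂)_f` (★ `conj_mem_comap_principalCongruenceLevel`).
[cite: BorelJacquet1979, §4.1] -/
theorem exists_normal_tauLevel_le {U₀ : Subgroup ↥(finAdelic (↥(maximalRealSubfield L)) L (IsCMField.complexConj L) 3 ((StdForm.antidiagonal 3).over L))} (hU₀ : IsTauLevel L U₀) :
    ∃ U₁ : Subgroup ↥(finAdelic (↥(maximalRealSubfield L)) L (IsCMField.complexConj L) 3 ((StdForm.antidiagonal 3).over L)), U₁ ≤ U₀ ∧ IsTauLevel L U₁ ∧ ∀ b ∈ (finAdelicIntegralLevel (↥(maximalRealSubfield L)) L (IsCMField.complexConj L) 3 ((StdForm.antidiagonal 3).over L)), ∀ u ∈ U₁, b * u * b⁻¹ ∈ U₁ := by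
  obtain ⟨n, hn, hle⟩ := exists_finCongruenceLevel_span_le_of_isOpen (F := ↥(maximalRealSubfield L)) (E := L) (c := IsCMField.complexConj L) (N := 3) (J := ((StdForm.antidiagonal 3).over L)) hU₀.1
  have h𝔫 : (Ideal.span {(n : 𝓞 L)} : Ideal (𝓞 L)) ≠ 0 := by
    rw [Ne, Ideal.zero_eq_bot, Ideal.span_singleton_eq_bot]
    exact_mod_cast hn
  refine ⟨finCongruenceLevel (↥(maximalRealSubfield L)) L (IsCMField.complexConj L) 3 ((StdForm.antidiagonal 3).over L) (Ideal.span {(n : 𝓞 L)}), hle,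
    ⟨isOpen_finCongruenceLevel (↥(maximalRealSubfield L)) L (IsCMField.complexConj L) 3 ((StdForm.antidiagonal 3).over L) h𝔫, isCompact_finCongruenceLevel (↥(maximalRealSubfield L)) L (IsCMField.complexConj L) 3 ((StdForm.antidiagonal 3).over L) h𝔫,
      finCongruenceLevel_le_integralLevel (↥(maximalRealSubfield L)) L (IsCMField.complexConj L) 3 ((StdForm.antidiagonal 3).over L) _⟩, fun b hb u hu => ?_⟩
  rw [mem_finCongruenceLevel_iff] at hu ⊢
  rw [mem_finAdelicIntegralLevel_iff] at hb
  have h := BigHeckeGLn.conj_mem_comap_principalCongruenceLevel hb (Subgroup.mem_comap.2 hu)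
  simpa only [Subgroup.mem_comap, Subgroup.coe_mul, Subgroup.coe_inv] using h

/-! ## §6.1 The exports row is additive -/

/-- **§6.1 — `exportsRow_finset_sum`: THE EXPORTS CLAUSE LIST IS CLOSED UNDER FINITE SUMS.**  If each `cᵢ` has a continuation `Ecᵢ` with a closed co-discrete pole set `Pᵢ ⊆ {Re ≤ 2}`, the tube
identity `Ecᵢ z = E(f_z^{cᵢ})` on `2 < Re`, analyticity, (E4) and (E2-bd) off `Pᵢ`, and each `E(f_z^{cᵢ})(g)` converges for `2 < Re z` (`hs`), then `Σ cᵢ` has the continuation `Σ Ecᵢ` with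
pole set `⋃ Pᵢ` and the same clause list. [cite: MoeglinWaldspurger1995, II.1.5, IV.1.9] [cite: BernsteinLapid2019, Thm 2.3] -/
theorem exportsRow_finset_sum {ι : Type} [Fintype ι] (c : ι → (quasiSplit (↥(maximalRealSubfield L)) L (IsCMField.complexConj L) 3).Adelic → ℂ) (Ec : ι → ℂ → (quasiSplit (↥(maximalRealSubfield L)) L (IsCMField.complexConj L) 3).Adelic → ℂ) (P : ι → Set ℂ)
    (hPc : ∀ i, IsClosed (P i)) (hPcd : ∀ i, ∀ z₀ : ℂ, ∀ᶠ s in 𝓝[≠] z₀, s ∉ P i) (hPre : ∀ i, ∀ z ∈ P i, z.re ≤ 2)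
    (hE2 : ∀ i, ∀ z : ℂ, 2 < z.re → Ec i z = eisensteinSeriesU (flatSectionU (c i) z))
    (hEan : ∀ i g (z : ℂ), z ∉ P i → AnalyticAt ℂ (fun z => Ec i z g) z) (hE4 : ∀ i (z : ℂ), z ∉ P i → Continuous (Ec i z))
    (hEbd : ∀ i (z₁ : ℂ), z₁ ∉ P i → ∀ K : Set (quasiSplit (↥(maximalRealSubfield L)) L (IsCMField.complexConj L) 3).Adelic, IsCompact K → ∃ V ∈ 𝓝 z₁, ∃ M : ℝ, ∀ z ∈ V, ∀ g ∈ K, ‖Ec i z g‖ ≤ M)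
    (hs : ∀ i (z : ℂ), 2 < z.re → ∀ g : (quasiSplit (↥(maximalRealSubfield L)) L (IsCMField.complexConj L) 3).Adelic, Summable fun q : (Quotient (MulAction.orbitRel ↥(borelU ((IsCMField.complexConj L : L ≃ₐ[↥(maximalRealSubfield L)] L) : L →+* L) ((StdForm.antidiagonal 3).over L)) ↥(unitaryGroupOfForm ((IsCMField.complexConj L : L ≃ₐ[↥(maximalRealSubfield L)] L) : L →+* L) ((StdForm.antidiagonal 3).over L)))) => flatSectionU (c i) z (((quasiSplit (↥(maximalRealSubfield L)) L (IsCMField.complexConj L) 3).toAdelic (Quotient.out q : ↥(unitaryGroupOfForm ((IsCMField.complexConj L : L ≃ₐ[↥(maximalRealSubfield L)] L) : L →+* L) ((StdForm.antidiagonal 3).over L)))) * g)) :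
    ∃ (Ec' : ℂ → (quasiSplit (↥(maximalRealSubfield L)) L (IsCMField.complexConj L) 3).Adelic → ℂ) (P : Set ℂ), IsClosed P ∧ (∀ z₀ : ℂ, ∀ᶠ s in 𝓝[≠] z₀, s ∉ P) ∧ (∀ z ∈ P, z.re ≤ 2) ∧
        (∀ z : ℂ, 2 < z.re → Ec' z = eisensteinSeriesU (flatSectionU (∑ i, c i) z)) ∧ (∀ g (z : ℂ), z ∉ P → AnalyticAt ℂ (fun z => Ec' z g) z) ∧
        (∀ z : ℂ, z ∉ P → Continuous (Ec' z)) ∧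
        (∀ z₁ : ℂ, z₁ ∉ P → ∀ K : Set (quasiSplit (↥(maximalRealSubfield L)) L (IsCMField.complexConj L) 3).Adelic, IsCompact K → ∃ V ∈ 𝓝 z₁, ∃ M : ℝ, ∀ z ∈ V, ∀ g ∈ K, ‖Ec' z g‖ ≤ M) := by
  refine ⟨fun z g => ∑ i, Ec i z g, ⋃ i, P i, isClosed_iUnion_of_finite hPc, fun z₀ => ?_, fun z hz => ?_, fun z hz => ?_, fun g z hz => ?_, fun z hz => ?_, fun z₁ hz₁ K hK => ?_⟩
  · exact (eventually_all.2 fun i => hPcd i z₀).mono fun s hs h => by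
      obtain ⟨i, hi⟩ := mem_iUnion.1 h
      exact hs i hi
  · obtain ⟨i, hi⟩ := mem_iUnion.1 hz
    exact hPre i z hi
  · funext g
    show ∑ i, Ec i z g = eisensteinSeriesU (flatSectionU (∑ i, c i) z) g
    rw [flatSectionU_finsetSum, eisensteinSeriesU_finsetSum_apply L _ _ g (fun i _ => hs i z hz g)]
    exact Finset.sum_congr rfl fun i _ => by rw [hE2 i z hz]
  · have hi : ∀ i, z ∉ P i := fun i h => hz (mem_iUnion.2 ⟨i, h⟩)
    have h := Finset.analyticAt_sum Finset.univ (fun i _ => hEan i g z (hi i))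
    rwa [Finset.sum_fn] at h
  · have hi : ∀ i, z ∉ P i := fun i h => hz (mem_iUnion.2 ⟨i, h⟩)
    exact continuous_finsetSum Finset.univ fun i _ => hE4 i z (hi i)
  · have hi : ∀ i, z₁ ∉ P i := fun i h => hz₁ (mem_iUnion.2 ⟨i, h⟩)
    choose V hV M hM using fun i => hEbd i z₁ (hi i) K hK
    refine ⟨⋂ i, V i, (iInter_mem).2 hV, ∑ i, M i, fun z hz g hg => (norm_sum_le _ _).trans (Finset.sum_le_sum fun i _ => hM i z (mem_iInter.1 hz i) g hg)⟩

/-! ## §6.2 HEAD: `hTEXP` at every `K_∞`-finite τ-admissible generator, from the exports at PURE blocks -/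

section Head

variable (ξ : OneDimAutRepH L) (μω : HeckeCharacter L)

/-- **§6.2 HEAD — `exportsTauRow_of_pureBlocks`**: for the `φ_ξ`-block with unitary characters (`hχ₁u : (ξ.bcη⁻¹ξ.bcψ⁻¹μω).IsUnitary`, `hχ₂u : |ξ.ψ| = 1`; ★ `isUnitary_blockChar`), the Godement
letter `hsum` (★ `hSUM_of_unitary`) and the PURE-BLOCK EXPORTS LETTER `hPURE` (exports datum for every section of a pure block packaged EXACTLY as ★ §5d
`exists_finset_sum_pure_blocks_of_isArchFinite` — `FiniteDimensional`, `hVK`, `hVχ`, `hVc`, `hVM`, level `(tauLevel U₀, 1)`, `K_max`-irreducible, pure `K_∞`-type), the exports row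
`hTEXP` of ★ `hEXP_tauRow_of_exportsRow` holds at EVERY τ-admissible generator `(U₀, φ)` BYTE FOR BYTE: shrink to a normal principal level `U₁ ≤ U₀` (`exists_normal_tauLevel_le`,
`chiSectionSpacePair_tauLevel_mono`), split `φ = Σ cᵢ` into pure blocks (★ §5d; `φ` is bounded by ★ `exists_norm_le_of_isChiSectionPair`), export each `cᵢ` by `hPURE`, add by
`exportsRow_finset_sum` (summability of each piece from `hsum`: the pieces are continuous level-free pair-sections). [cite: MoeglinWaldspurger1995, II.1.5, IV.1.9–IV.1.11]
[cite: BernsteinLapid2019, Thm 2.3, §4] [cite: BorelJacquet1979, §4.1] -/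
theorem exportsTauRow_of_pureBlocks (hχ₁u : ((ξ.bcη⁻¹ * ξ.bcψ⁻¹ * μω)).IsUnitary) (hχ₂u : ∀ t, ‖((ξ.ψ t : ℂˣ) : ℂ)‖ = 1)
    (hsum : ∀ φ ∈ chiSectionSpacePair (ξ.bcη⁻¹ * ξ.bcψ⁻¹ * μω) ξ.ψ (⊥ : Subgroup (quasiSplit (↥(maximalRealSubfield L)) L (IsCMField.complexConj L) 3).Adelic) ((1 : ↥(⊥ : Subgroup (quasiSplit (↥(maximalRealSubfield L)) L (IsCMField.complexConj L) 3).Adelic) →* ℂ) : ↥(⊥ : Subgroup (quasiSplit (↥(maximalRealSubfield L)) L (IsCMField.complexConj L) 3).Adelic) → ℂ), Continuous φ → ∀ z : ℂ, 2 < z.re → ∀ g : (quasiSplit (↥(maximalRealSubfield L)) L (IsCMField.complexConj L) 3).Adelic,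
      Summable fun q : (Quotient (MulAction.orbitRel ↥(borelU ((IsCMField.complexConj L : L ≃ₐ[↥(maximalRealSubfield L)] L) : L →+* L) ((StdForm.antidiagonal 3).over L)) ↥(unitaryGroupOfForm ((IsCMField.complexConj L : L ≃ₐ[↥(maximalRealSubfield L)] L) : L →+* L) ((StdForm.antidiagonal 3).over L)))) => ‖flatSectionU φ z (((quasiSplit (↥(maximalRealSubfield L)) L (IsCMField.complexConj L) 3).toAdelic (Quotient.out q : ↥(unitaryGroupOfForm ((IsCMField.complexConj L : L ≃ₐ[↥(maximalRealSubfield L)] L) : L →+* L) ((StdForm.antidiagonal 3).over L)))) * g)‖)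
    (hPURE : ∀ (U₀ : Subgroup ↥(finAdelic (↥(maximalRealSubfield L)) L (IsCMField.complexConj L) 3 ((StdForm.antidiagonal 3).over L))) (_ : IsTauLevel L U₀) (V : Submodule ℂ ((quasiSplit (↥(maximalRealSubfield L)) L (IsCMField.complexConj L) 3).Adelic → ℂ)) (_ : FiniteDimensional ℂ ↥V)
      (_ : ∀ k ∈ ((standardMaximalCompactGL 3 L).comap (adelicVal (↥(maximalRealSubfield L)) L (IsCMField.complexConj L) 3 ((StdForm.antidiagonal 3).over L)) : Subgroup (quasiSplit (↥(maximalRealSubfield L)) L (IsCMField.complexConj L) 3).Adelic), ∀ ψ ∈ V, (fun x => ψ (x * k)) ∈ V) (_ : ∀ ψ ∈ V, IsChiSectionPair (ξ.bcη⁻¹ * ξ.bcψ⁻¹ * μω) ξ.ψ ψ) (_ : ∀ ψ ∈ V, Continuous ψ)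
      (_ : ∀ ψ ∈ V, ∃ M : ℝ, ∀ x, ‖ψ x‖ ≤ M) (_ : V ≤ chiSectionSpacePair (ξ.bcη⁻¹ * ξ.bcψ⁻¹ * μω) ξ.ψ (tauLevel L U₀) ((1 : ↥(tauLevel L U₀) →* ℂ) : ↥(tauLevel L U₀) → ℂ))
      (_ : ∃ hV : ∀ k : ↥((standardMaximalCompactGL 3 L).comap (adelicVal (↥(maximalRealSubfield L)) L (IsCMField.complexConj L) 3 ((StdForm.antidiagonal 3).over L)) : Subgroup (quasiSplit (↥(maximalRealSubfield L)) L (IsCMField.complexConj L) 3).Adelic), ∀ ψ ∈ V, ((rightTranslation (quasiSplit (↥(maximalRealSubfield L)) L (IsCMField.complexConj L) 3)).comp ((standardMaximalCompactGL 3 L).comap (adelicVal (↥(maximalRealSubfield L)) L (IsCMField.complexConj L) 3 ((StdForm.antidiagonal 3).over L)) : Subgroup (quasiSplit (↥(maximalRealSubfield L)) L (IsCMField.complexConj L) 3).Adelic).subtype) k ψ ∈ V, (Subrepresentation.toRepresentation (⟨V, hV⟩ : Subrepresentation ((rightTranslation (quasiSplit (↥(maximalRealSubfield L)) L (IsCMField.complexConj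 L) 3)).comp ((standardMaximalCompactGL 3 L).comap (adelicVal (↥(maximalRealSubfield L)) L (IsCMField.complexConj L) 3 ((StdForm.antidiagonal 3).over L)) : Subgroup (quasiSplit (↥(maximalRealSubfield L)) L (IsCMField.complexConj L) 3).Adelic).subtype))).IsIrreducible)
      (_ : ∃ (W₀ : Submodule ℂ ((quasiSplit (↥(maximalRealSubfield L)) L (IsCMField.complexConj L) 3).Adelic → ℂ)) (hW₀K : ∀ k : ↥(archMaximalCompact L), ∀ ψ ∈ W₀, ((rightTranslation (quasiSplit (↥(maximalRealSubfield L)) L (IsCMField.complexConj L) 3)).comp (archMaximalCompact L).subtype) k ψ ∈ W₀),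
        FiniteDimensional ℂ ↥W₀ ∧ (Subrepresentation.toRepresentation (⟨W₀, hW₀K⟩ : Subrepresentation ((rightTranslation (quasiSplit (↥(maximalRealSubfield L)) L (IsCMField.complexConj L) 3)).comp (archMaximalCompact L).subtype))).IsIrreducible ∧
        V ≤ chiSectionSpacePairKType (ξ.bcη⁻¹ * ξ.bcψ⁻¹ * μω) ξ.ψ (tauLevel L U₀) ((1 : ↥(tauLevel L U₀) →* ℂ) : ↥(tauLevel L U₀) → ℂ) (archMaximalCompact L).subtype (commute_tauLevel_archMaximalCompact L U₀) (Subrepresentation.toRepresentation (⟨W₀, hW₀K⟩ : Subrepresentation ((rightTranslation (quasiSplit (↥(maximalRealSubfield L)) L (IsCMField.complexConj L) 3)).comp (archMaximalCompact L).subtype)))),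
      ∀ φ ∈ V, ∃ (Ec' : ℂ → (quasiSplit (↥(maximalRealSubfield L)) L (IsCMField.complexConj L) 3).Adelic → ℂ) (P : Set ℂ), IsClosed P ∧ (∀ z₀ : ℂ, ∀ᶠ s in 𝓝[≠] z₀, s ∉ P) ∧ (∀ z ∈ P, z.re ≤ 2) ∧
        (∀ z : ℂ, 2 < z.re → Ec' z = eisensteinSeriesU (flatSectionU φ z)) ∧ (∀ g (z : ℂ), z ∉ P → AnalyticAt ℂ (fun z => Ec' z g) z) ∧
        (∀ z : ℂ, z ∉ P → Continuous (Ec' z)) ∧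
        (∀ z₁ : ℂ, z₁ ∉ P → ∀ K : Set (quasiSplit (↥(maximalRealSubfield L)) L (IsCMField.complexConj L) 3).Adelic, IsCompact K → ∃ V ∈ 𝓝 z₁, ∃ M : ℝ, ∀ z ∈ V, ∀ g ∈ K, ‖Ec' z g‖ ≤ M)) :
    ∀ (U₀ : Subgroup ↥(finAdelic (↥(maximalRealSubfield L)) L (IsCMField.complexConj L) 3 ((StdForm.antidiagonal 3).over L))) (_ : IsTauLevel L U₀) (φ : (quasiSplit (↥(maximalRealSubfield L)) L (IsCMField.complexConj L) 3).Adelic → ℂ) (_ : φ ∈ chiSectionSpacePair (ξ.bcη⁻¹ * ξ.bcψ⁻¹ * μω) ξ.ψ (tauLevel L U₀) ((1 : ↥(tauLevel L U₀) →* ℂ) : ↥(tauLevel L U₀) → ℂ)) (_ : Continuous φ) (_ : IsArchFinite L φ),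
      ∃ (Ec' : ℂ → (quasiSplit (↥(maximalRealSubfield L)) L (IsCMField.complexConj L) 3).Adelic → ℂ) (P : Set ℂ), IsClosed P ∧ (∀ z₀ : ℂ, ∀ᶠ s in 𝓝[≠] z₀, s ∉ P) ∧ (∀ z ∈ P, z.re ≤ 2) ∧
        (∀ z : ℂ, 2 < z.re → Ec' z = eisensteinSeriesU (flatSectionU φ z)) ∧ (∀ g (z : ℂ), z ∉ P → AnalyticAt ℂ (fun z => Ec' z g) z) ∧
        (∀ z : ℂ, z ∉ P → Continuous (Ec' z)) ∧
        (∀ z₁ : ℂ, z₁ ∉ P → ∀ K : Set (quasiSplit (↥(maximalRealSubfield L)) L (IsCMField.complexConj L) 3).Adelic, IsCompact K → ∃ V ∈ 𝓝 z₁, ∃ M : ℝ, ∀ z ∈ V, ∀ g ∈ K, ‖Ec' z g‖ ≤ M) := by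
  intro U₀ hU₀ φ hφ hφc hφa
  -- a normal principal level below `U₀`; `φ` is bounded (unitary characters)
  obtain ⟨U₁, hU₁U₀, hU₁, hN⟩ := exists_normal_tauLevel_le L hU₀
  have hφ₁ := chiSectionSpacePair_tauLevel_mono L (χ₁ := (ξ.bcη⁻¹ * ξ.bcψ⁻¹ * μω)) (χ₂ := ξ.ψ) hU₁U₀ hφ
  have hφM : ∃ M : ℝ, ∀ x, ‖φ x‖ ≤ M := exists_norm_le_of_isChiSectionPair L hχ₁u hχ₂u (isChiSectionPair_of_mem hφ) hφc
  -- split into pure blocks at the normal level `U₁`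
  obtain ⟨ι, hι, V, c, hsumφ, hc⟩ := exists_finset_sum_pure_blocks_of_isArchFinite L ξ μω hU₁ hN hφ₁ hφc hφM hφa
  -- export each piece and collect the data
  have hexp : ∀ i, ∃ (Ec' : ℂ → (quasiSplit (↥(maximalRealSubfield L)) L (IsCMField.complexConj L) 3).Adelic → ℂ) (P : Set ℂ), IsClosed P ∧ (∀ z₀ : ℂ, ∀ᶠ s in 𝓝[≠] z₀, s ∉ P) ∧ (∀ z ∈ P, z.re ≤ 2) ∧
        (∀ z : ℂ, 2 < z.re → Ec' z = eisensteinSeriesU (flatSectionU (c i) z)) ∧ (∀ g (z : ℂ), z ∉ P → AnalyticAt ℂ (fun z => Ec' z g) z) ∧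
        (∀ z : ℂ, z ∉ P → Continuous (Ec' z)) ∧
        (∀ z₁ : ℂ, z₁ ∉ P → ∀ K : Set (quasiSplit (↥(maximalRealSubfield L)) L (IsCMField.complexConj L) 3).Adelic, IsCompact K → ∃ V ∈ 𝓝 z₁, ∃ M : ℝ, ∀ z ∈ V, ∀ g ∈ K, ‖Ec' z g‖ ≤ M) := fun i => by
    obtain ⟨hcV, -, hVfd, hVK, hVχ, hVc, hVM, hVlev, hVirr, hVpure⟩ := hc i
    exact hPURE U₁ hU₁ (V i) hVfd hVK hVχ hVc hVM hVlev hVirr hVpure (c i) hcV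
  choose Ec P hPc hPcd hPre hE2 hEan hE4 hEbd using hexp
  -- summability of each piece on `2 < Re` from the Godement letter (the pieces are continuous level-free pair-sections)
  have hS : (Submodule.span ℂ (Set.range fun k : ↥((standardMaximalCompactGL 3 L).comap (adelicVal (↥(maximalRealSubfield L)) L (IsCMField.complexConj L) 3 ((StdForm.antidiagonal 3).over L)) : Subgroup (quasiSplit (↥(maximalRealSubfield L)) L (IsCMField.complexConj L) 3).Adelic) => ((rightTranslation (quasiSplit (↥(maximalRealSubfield L)) L (IsCMField.complexConj L) 3)).comp ((standardMaximalCompactGL 3 L).comap (adelicVal (↥(maximalRealSubfield L)) L (IsCMField.complexConj L) 3 ((StdForm.antidiagonal 3).over L)) : Subgroup (quasiSplit (↥(maximalRealSubfield L)) L (IsCMField.complexConj L) 3).Adelic).subtype) k φ)) ≤ chiSectionSpacePair (ξ.bcη⁻¹ * ξ.bcψ⁻¹ * μω) ξ.ψ (⊥ : Subgroup (quasiSplit (↥(maximalRealSubfield L)) L (IsCMField.complexConj L) 3).Adelic) ((1 : ↥(⊥ : Subgroup (quasiSplit (↥(maximalRealSubfield L)) L (IsCMField.complexConj L) 3).Adelic)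 →* ℂ) : ↥(⊥ : Subgroup (quasiSplit (↥(maximalRealSubfield L)) L (IsCMField.complexConj L) 3).Adelic) → ℂ) := span_kMaxTranslates_le_chiSectionSpacePair_bot L hφ₁
  have hs : ∀ i (z : ℂ), 2 < z.re → ∀ g : (quasiSplit (↥(maximalRealSubfield L)) L (IsCMField.complexConj L) 3).Adelic, Summable fun q : (Quotient (MulAction.orbitRel ↥(borelU ((IsCMField.complexConj L : L ≃ₐ[↥(maximalRealSubfield L)] L) : L →+* L) ((StdForm.antidiagonal 3).over L)) ↥(unitaryGroupOfForm ((IsCMField.complexConj L : L ≃ₐ[↥(maximalRealSubfield L)] L) : L →+* L) ((StdForm.antidiagonal 3).over L)))) => flatSectionU (c i) z (((quasiSplit (↥(maximalRealSubfield L)) L (IsCMField.complexConj L) 3).toAdelic (Quotient.out q : ↥(unitaryGroupOfForm ((IsCMField.complexConj L : L ≃ₐ[↥(maximalRealSubfield L)] L) : L →+* L) ((StdForm.antidiagonal 3).over L)))) * g) := fun i z hz g => by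
    obtain ⟨hcV, hVS, -, -, -, hVc, -⟩ := hc i
    exact (hsum (c i) (hS (hVS hcV)) (hVc (c i) hcV) z hz g).of_norm
  rw [hsumφ]
  exact exportsRow_finset_sum L c Ec P hPc hPcd hPre hE2 hEan hE4 hEbd hs

end Head

end Summit.HodgeConjecture.HodgeConjecture.R90.S8

end
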